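import Literature.LinearAlgebra.Matrix.QInversiveCompanion
import HarnessLib

/-!
# Goresky–Tai 2017, §4.1–§4.2: `GL_n^*` — the subgroup of `GSp_{2n}` fixed under conjugation by `τ₀` is the image
# of `δ(λ, X) = diag(λX, ᵗX⁻¹)`; conjugating a `q`-inversive element by `δ(λ, X)` (formula (4.6))

Topic `Literature/LinearAlgebra/Matrix`; THEOREMS ONLY (no definition, no instance, no named fact; D-0026 net
debt 0).  Lane `lit-hodgefound` (summit `HodgeConjecture`, Track 2 foundations library), seat
`lit-hodgefound-p15`, generation 56, row g56-#12; complements `QInversiveCompanion` (g56-#4: the case `λ = 1`,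
`δ(1, X) = Sp.levi X`: `levi_conj_fromBlocks`, `relations_levi_conj`).

THE PRINT.  M. Goresky, Y.-S. Tai, *Real structures on ordinary Abelian varieties*, arXiv:1701.07742
[GoreskyTai2017RealStructuresOrdinary], §4.1 (p0011) and §4.2 (4.6) (p0011), verbatim:

> Define the standard involution `τ₀ = (−I 0; 0 I)`. The subgroup of `GSp_{2n}(R)` that is fixed under
> conjugation by `τ₀` is denoted `GL*_n(R)`, and it is the image of the standard embedding
> `δ : R^× × GL_n(R) → GSp_{2n}(R)`, `δ(λ, x) = (λX 0; 0 ᵗX⁻¹)`.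
> (4.6) Let `γ = (A B; C ᵗA) ∈ GSp_{2n}(L)`. Let `x = (λX 0; 0 ᵗX⁻¹) ∈ GL*_n(L)`. Then
> `xγx⁻¹ = (XAX⁻¹, λXBᵗX; λ⁻¹ᵗX⁻¹CX⁻¹, ᵗX⁻¹ᵗAᵗX)`. It follows that `γ` is `q`-inversive if and only if `xγx⁻¹` is
> `q`-inversive.

WHAT IS HERE (commutative ring `R`; `τ₀ = fromBlocks (−1) 0 0 1`, the tree's; GT's `J = (0 I; −I 0)` versus
Mathlib's `J = (0 −I; I 0)` only changes the sign convention of the multiplier equation, stated here as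
`ᵗgJg = λJ` with Mathlib's `J` like the rest of the lineage):
* §1 `tau0_conj_eq_iff` (`τ₀gτ₀ = g` ⟺ the off-diagonal blocks `U, V` satisfy `U = −U`, `V = −V`; with `2` a
  non-zero-divisor ⟺ `U = V = 0`: `tau0_conj_eq_iff_of_two`), `fromBlocks_diag_multiplier_iff` (`diag(P, Q)` has
  multiplier `λ` iff `ᵗPQ = λI`).
* §2 `δ(λ, X) = fromBlocks (λ • X) 0 0 Xᵀ⁻¹`: `delta_multiplier` (multiplier `λ`), `tau0_conj_delta` (fixed by
  `τ₀`), `delta_eq_mul_levi` (`δ(λ, X) = diag(λI, I)·levi(X)`), and the converse **`exists_eq_delta`**: a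
  `τ₀`-fixed `g` with unit multiplier `λ` is `δ(λ, X)` for a (unique, `X = λ⁻¹P`) invertible `X` — «`GL*_n` is the
  image of `δ`».
* §3 formula **(4.6)** `delta_conj_fromBlocks` and «`γ` is `q`-inversive iff `xγx⁻¹` is»: `relations_delta_conj`
  (the transported blocks satisfy the `q`-inversive relations), with the scaling step `relations_smul`.

## References
* [GoreskyTai2017RealStructuresOrdinary] M. Goresky, Y.-S. Tai, Real structures on ordinary Abelian varieties,
  arXiv:1701.07742 (2017), §4.1 (definition of `GL*_n`, `δ`) and §4.2 formula (4.6) (p0011).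
-/

open Matrix

namespace Literature.LinearAlgebra.Matrix.SymplecticTau0FixedSubgroup

variable {R : Type*} [CommRing R] {m : Type*} [Fintype m] [DecidableEq m]

/-! ## §1 Fixed points of `τ₀`-conjugation; multiplier of a block-diagonal element -/

/-- `τ₀gτ₀ = g` iff the off-diagonal blocks of `g` are their own negatives.
[cite: GoreskyTai2017RealStructuresOrdinary, §4.1 «The subgroup of GSp_2n(R) that is fixed under conjugation by τ₀» (p0011)] -/
theorem tau0_conj_eq_iff (P U V Q : Matrix m m R) :
    fromBlocks (-1 : Matrix m m R) 0 0 1 * fromBlocks P U V Q * fromBlocks (-1 : Matrix m m R) 0 0 1 =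
        fromBlocks P U V Q ↔ -U = U ∧ -V = V := by
  rw [QInversiveCharpoly.tau0_mul_fromBlocks_mul_tau0, fromBlocks_inj]
  simp only [true_and, and_true]

/-- With `2` a non-zero-divisor: `τ₀gτ₀ = g` iff `g` is block diagonal.
[cite: GoreskyTai2017RealStructuresOrdinary, §4.1 (p0011)] -/
theorem tau0_conj_eq_iff_of_two (h2 : (2 : R) ∈ nonZeroDivisors R) (P U V Q : Matrix m m R) :
    fromBlocks (-1 : Matrix m m R) 0 0 1 * fromBlocks P U V Q * fromBlocks (-1 : Matrix m m R) 0 0 1 =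
        fromBlocks P U V Q ↔ U = 0 ∧ V = 0 := by
  rw [tau0_conj_eq_iff]
  have key : ∀ W : Matrix m m R, -W = W ↔ W = 0 := fun W => by
    constructor
    · intro h
      ext i j
      have e := congr_fun (congr_fun h i) j
      rw [neg_apply] at e
      have hij : W i j * 2 = 0 := by linear_combination -e
      exact (mul_right_mem_nonZeroDivisors_eq_zero_iff h2).mp hij
    · rintro rfl
      exact neg_zero
  rw [key, key]

/-- A block-diagonal `diag(P, Q)` has multiplier `λ` (`ᵗgJg = λJ`) iff `ᵗPQ = λI`.
[cite: GoreskyTai2017RealStructuresOrdinary, §4.1 «δ(λ, x) = (λX 0; 0 ᵗX⁻¹)» (p0011)] -/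
theorem fromBlocks_diag_multiplier_iff (P Q : Matrix m m R) (c : R) :
    (fromBlocks P 0 0 Q)ᵀ * J m R * fromBlocks P 0 0 Q = c • J m R ↔ Pᵀ * Q = c • (1 : Matrix m m R) := by
  rw [SymplecticSimilitude.fromBlocks_transpose_mul_J_mul_eq_smul_J_iff]
  simp only [transpose_zero, Matrix.zero_mul, Matrix.mul_zero, sub_zero, true_and]

/-! ## §2 `δ(λ, X) = diag(λX, ᵗX⁻¹)` -/

/-- `δ(λ, X)` has multiplier `λ`. [cite: GoreskyTai2017RealStructuresOrdinary, §4.1 «δ : R^× × GL_n(R) → GSp_2n(R)» (p0011)] -/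
theorem delta_multiplier {X : Matrix m m R} (hX : IsUnit X.det) (c : R) :
    (fromBlocks (c • X) 0 0 Xᵀ⁻¹)ᵀ * J m R * fromBlocks (c • X) 0 0 Xᵀ⁻¹ = c • J m R := by
  rw [fromBlocks_diag_multiplier_iff, transpose_smul, Matrix.smul_mul,
    Matrix.mul_nonsing_inv _ (by rw [det_transpose]; exact hX)]

/-- `δ(λ, X)` is fixed by `τ₀`-conjugation. [cite: GoreskyTai2017RealStructuresOrdinary, §4.1 (p0011)] -/
theorem tau0_conj_delta (X : Matrix m m R) (c : R) :
    fromBlocks (-1 : Matrix m m R) 0 0 1 * fromBlocks (c • X) 0 0 Xᵀ⁻¹ * fromBlocks (-1 : Matrix m m R) 0 0 1 =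
      fromBlocks (c • X) 0 0 Xᵀ⁻¹ := by
  rw [tau0_conj_eq_iff, neg_zero]
  exact ⟨rfl, rfl⟩

/-- `δ(λ, X) = diag(λI, I) · levi(X)` (`levi(X) = diag(X, ᵗX⁻¹) = δ(1, X)`).
[cite: GoreskyTai2017RealStructuresOrdinary, §4.1 (p0011)] -/
theorem delta_eq_mul_levi (X : Matrix m m R) (c : R) :
    fromBlocks (c • X) 0 0 Xᵀ⁻¹ = fromBlocks (c • (1 : Matrix m m R)) 0 0 1 * Sp.levi X := by
  rw [Sp.levi, fromBlocks_multiply, transpose_nonsing_inv]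
  simp

/-- **`GL*_n` is the image of `δ`**: a `τ₀`-fixed `g` with a UNIT multiplier `λ` (`ᵗgJg = λJ`), over a ring in
which `2` is a non-zero-divisor, is `δ(λ, X)` with `X = λ⁻¹P` invertible.
[cite: GoreskyTai2017RealStructuresOrdinary, §4.1 «it is the image of the standard embedding δ» (p0011)] -/
theorem exists_eq_delta (h2 : (2 : R) ∈ nonZeroDivisors R) {g : Matrix (m ⊕ m) (m ⊕ m) R} {c : R} (hc : IsUnit c)
    (hmul : gᵀ * J m R * g = c • J m R)
    (hfix : fromBlocks (-1 : Matrix m m R) 0 0 1 * g * fromBlocks (-1 : Matrix m m R) 0 0 1 = g) :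
    ∃ X : Matrix m m R, IsUnit X.det ∧ g = fromBlocks (c • X) 0 0 Xᵀ⁻¹ := by
  obtain ⟨u, rfl⟩ := hc
  -- write `g` in blocks; `τ₀`-fixed means block diagonal
  obtain ⟨P, U, V, Q, rfl⟩ : ∃ P U V Q : Matrix m m R, g = fromBlocks P U V Q :=
    ⟨g.toBlocks₁₁, g.toBlocks₁₂, g.toBlocks₂₁, g.toBlocks₂₂, (fromBlocks_toBlocks g).symm⟩
  obtain ⟨rfl, rfl⟩ := (tau0_conj_eq_iff_of_two h2 P U V Q).mp hfix
  rw [fromBlocks_diag_multiplier_iff] at hmul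
  -- `ᵗP Q = u I`: `P` is invertible and `Q = u ᵗP⁻¹`
  have hPQ : ((↑(u⁻¹) : R) • Pᵀ) * Q = 1 := by rw [Matrix.smul_mul, hmul, smul_smul, Units.inv_mul, one_smul]
  have hPt : IsUnit Pᵀ.det := by
    have h' := isUnit_det_of_right_inverse hPQ
    rw [det_smul] at h'
    exact isUnit_of_mul_isUnit_right h'
  have hP : IsUnit P.det := by rwa [det_transpose] at hPt
  refine ⟨(↑(u⁻¹) : R) • P, ?_, ?_⟩
  · rw [det_smul]
    exact ((u⁻¹).isUnit.pow _).mul hP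
  · rw [smul_smul, Units.mul_inv, one_smul, transpose_smul, (Matrix.inv_eq_right_inv hPQ)]

/-! ## §3 Formula (4.6) and «`γ` is `q`-inversive iff `xγx⁻¹` is» -/

/-- The inverse of `δ(λ, X)`. [cite: GoreskyTai2017RealStructuresOrdinary, §4.2 (4.6) (p0011)] -/
theorem delta_mul_delta_inv {X : Matrix m m R} (hX : IsUnit X.det) (u : Rˣ) :
    fromBlocks ((u : R) • X) 0 0 Xᵀ⁻¹ * fromBlocks ((↑u⁻¹ : R) • X⁻¹) 0 0 Xᵀ = 1 := by
  rw [fromBlocks_multiply]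
  simp only [Matrix.zero_mul, Matrix.mul_zero, add_zero, zero_add, Matrix.smul_mul, Matrix.mul_smul, smul_smul,
    Units.inv_mul, one_smul, smul_zero, Matrix.mul_nonsing_inv _ hX,
    Matrix.nonsing_inv_mul _ (show IsUnit Xᵀ.det by rw [det_transpose]; exact hX), fromBlocks_one]

/-- **Formula (4.6)**: `δ(λ, X)·(A B; C ᵗA)·δ(λ, X)⁻¹ = (XAX⁻¹, λXBᵗX; λ⁻¹ᵗX⁻¹CX⁻¹, ᵗ(XAX⁻¹))`.
[cite: GoreskyTai2017RealStructuresOrdinary, §4.2 (4.6) (p0011)] -/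
theorem delta_conj_fromBlocks (X : Matrix m m R) (u : Rˣ) (A B C : Matrix m m R) :
    fromBlocks ((u : R) • X) 0 0 Xᵀ⁻¹ * fromBlocks A B C Aᵀ * fromBlocks ((↑u⁻¹ : R) • X⁻¹) 0 0 Xᵀ =
      fromBlocks (X * A * X⁻¹) ((u : R) • (X * B * Xᵀ)) ((↑u⁻¹ : R) • (X⁻¹ᵀ * C * X⁻¹)) (X * A * X⁻¹)ᵀ := by
  rw [fromBlocks_multiply, fromBlocks_multiply]
  simp only [Matrix.zero_mul, Matrix.mul_zero, add_zero, zero_add, Matrix.smul_mul, Matrix.mul_smul, smul_smul,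
    Units.inv_mul, one_smul, transpose_nonsing_inv]
  congr 1
  rw [transpose_mul, transpose_mul, transpose_nonsing_inv, Matrix.mul_assoc]

/-- The scaling step `(A, B, C) ↦ (A, λB, λ⁻¹C)` preserves the `q`-inversive relations.
[cite: GoreskyTai2017RealStructuresOrdinary, §4.2 «It follows that γ is q-inversive if and only if xγx⁻¹ is q-inversive» (p0011)] -/
theorem relations_smul (u : Rˣ) {A B C : Matrix m m R} {q : R} (hB : Bᵀ = B) (hC : Cᵀ = C)
    (hAB : A * B = B * Aᵀ) (hCA : C * A = Aᵀ * C) (hq : A * A - B * C = q • (1 : Matrix m m R)) :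
    ((u : R) • B)ᵀ = (u : R) • B ∧ ((↑u⁻¹ : R) • C)ᵀ = (↑u⁻¹ : R) • C ∧
      A * ((u : R) • B) = ((u : R) • B) * Aᵀ ∧ ((↑u⁻¹ : R) • C) * A = Aᵀ * ((↑u⁻¹ : R) • C) ∧
      A * A - ((u : R) • B) * ((↑u⁻¹ : R) • C) = q • (1 : Matrix m m R) := by
  refine ⟨by rw [transpose_smul, hB], by rw [transpose_smul, hC], by rw [Matrix.mul_smul, Matrix.smul_mul, hAB],
    by rw [Matrix.smul_mul, Matrix.mul_smul, hCA], ?_⟩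
  rw [Matrix.smul_mul, Matrix.mul_smul, smul_smul, Units.mul_inv, one_smul, hq]

/-- **«`γ` is `q`-inversive iff `xγx⁻¹` is»** for `x = δ(λ, X) ∈ GL*_n`: the blocks of (4.6) satisfy the
`q`-inversive relations. [cite: GoreskyTai2017RealStructuresOrdinary, §4.2 (4.6) and the sentence after it (p0011)] -/
theorem relations_delta_conj {X : Matrix m m R} (hX : IsUnit X.det) (u : Rˣ) {A B C : Matrix m m R} {q : R}
    (hB : Bᵀ = B) (hC : Cᵀ = C) (hAB : A * B = B * Aᵀ) (hCA : C * A = Aᵀ * C)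
    (hq : A * A - B * C = q • (1 : Matrix m m R)) :
    ((u : R) • (X * B * Xᵀ))ᵀ = (u : R) • (X * B * Xᵀ) ∧
      ((↑u⁻¹ : R) • (X⁻¹ᵀ * C * X⁻¹))ᵀ = (↑u⁻¹ : R) • (X⁻¹ᵀ * C * X⁻¹) ∧
      (X * A * X⁻¹) * ((u : R) • (X * B * Xᵀ)) = ((u : R) • (X * B * Xᵀ)) * (X * A * X⁻¹)ᵀ ∧
      ((↑u⁻¹ : R) • (X⁻¹ᵀ * C * X⁻¹)) * (X * A * X⁻¹) = (X * A * X⁻¹)ᵀ * ((↑u⁻¹ : R) • (X⁻¹ᵀ * C * X⁻¹)) ∧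
      (X * A * X⁻¹) * (X * A * X⁻¹) - ((u : R) • (X * B * Xᵀ)) * ((↑u⁻¹ : R) • (X⁻¹ᵀ * C * X⁻¹)) =
        q • (1 : Matrix m m R) := by
  obtain ⟨hB', hC', hAB', hCA', hq'⟩ := QInversiveCompanion.relations_levi_conj hX hB hC hAB hCA hq
  exact relations_smul u hB' hC' hAB' hCA' hq'

end Literature.LinearAlgebra.Matrix.SymplecticTau0FixedSubgroup
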